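import Summits.Ventures.PackingBounds.Configurations.ListConfig
import Summits.Ventures.PackingBounds.Configurations.SectionTransfer
import Summits.Ventures.PackingBounds.SphericalCodes.DimFourFifth

/-!
# The Petersen code: `10` points on `S³` with inner products `1/6`, `-2/3` (attained side of `A(4, arccos s) = 10`, `1/6 ≤ s ≤ 1/5`)

Framing: lottery ticket; floor = certified bounds/negative ranges. Venture `PackingBounds` (cell
`pub-packcert`, seat `pub-packcert-energy`) — attained-side kernel row requested by the lead (R9-4) for the B2c
cell `(4, 1/5)`.

The `10` vectors `e_i + e_j` (`i < j`) of `ℝ⁵` projected to the hyperplane `𝟙^⊥ ≅ ℝ⁴` and scaled by `5`: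
coordinates `3` at `i, j` and `-2` elsewhere, squared norm `30`, dot products `5` (pairs meeting in one index,
`6` per point; inner product `1/6`) and `-20` (disjoint pairs, `3` per point; inner product `-2/3`) — the Petersen
graph as a two-distance set, the `(4, 10, 1/6)` spherical code (a rectified 4-simplex). The kernel checks the
distance distribution and the orthogonality to `𝟙`; `Config.exists_section` moves the configuration to `ℝ⁴`.
Consequences: `A(4, arccos 1/6) ≥ 10`, hence `A(4, arccos s) ≥ 10` for every `s ≥ 1/6`; with the cell's
kernel-checked Delsarte bound `SphericalCodes.code_dim4_fifth_le_11`: `10 ≤ A(4, arccos 1/5) ≤ 11` in the kernel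
(the cell's exact three-point certificate gives `≤ 10`, not kernel-checked).

## References
* J. H. Conway, N. J. A. Sloane, *Sphere Packings, Lattices and Groups*, Ch. 1 §2.6 and Ch. 9 Table 9.2
  (small spherical codes). [`ConwaySloane1999`]
-/

namespace Summit.Ventures.PackingBounds.Config.PetersenCode

open Finset Summit.Ventures.PackingBounds.Config

/-- The `10` vectors `5(e_i + e_j) - 2·𝟙` of `ℤ⁵` (`i < j`), squared norm `30`, orthogonal to `𝟙`.
[cite: ConwaySloane1999, Ch. 9 Table 9.2] -/
def vecs : List (List ℤ) := [
  [3, 3, -2, -2, -2],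
  [3, -2, 3, -2, -2],
  [3, -2, -2, 3, -2],
  [3, -2, -2, -2, 3],
  [-2, 3, 3, -2, -2],
  [-2, 3, -2, 3, -2],
  [-2, 3, -2, -2, 3],
  [-2, -2, 3, 3, -2],
  [-2, -2, 3, -2, 3],
  [-2, -2, -2, 3, 3]]

/-- The distance table: dot products `5` (×6, inner product `1/6`) and `-20` (×3, inner product `-2/3`). -/
def table : List (ℤ × ℕ) := [(-20, 3), (5, 6)]

/-- The normal `𝟙 = (1,1,1,1,1)` of the hyperplane carrying the configuration. -/
def normals : List (List ℤ) := [[1, 1, 1, 1, 1]]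

/-- Kernel check: `10` coordinate lists. -/
theorem length_vecs : vecs.length = 10 := by decide +kernel

set_option maxRecDepth 100000 in
/-- Kernel check: every list has length `5` and squared length `30`. -/
private theorem shape_vecs : shapeOK vecs 5 (30 : ℤ) = true := by decide +kernel

/-- Kernel check: the table keys are distinct and differ from the squared length. -/
private theorem keys_table : keysOK table (30 : ℤ) = true := by decide +kernel

set_option maxRecDepth 100000 in
/-- Kernel check (the distance distribution). -/
private theorem hist_vecs : histOK vecs table vecs = true := by decide +kernel

/-- The coordinate lists are pairwise distinct (from the checks). -/
private theorem nodup_vecs : vecs.Nodup := nodup_of_checks shape_vecs keys_table hist_vecs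

/-- Kernel check: the normal has length `5` and is nonzero. -/
private theorem normals_ok : normalsOK normals 5 = true := by decide +kernel

set_option maxRecDepth 100000 in
/-- Kernel check: every vector is orthogonal to `𝟙`. -/
private theorem orth_ok : orthOK normals vecs = true := by decide +kernel

/-- `ι q > 0`. -/
private theorem hq : 0 < (Int.castRingHom ℝ) (30 : ℤ) := by simp

/-- **The configuration in `ℝ⁴`**: `10` unit vectors with pairwise inner products in `{1/6, -2/3}` and, for every
potential `a`, energy `10 (3 a(-2/3) + 6 a(1/6))`. -/
theorem exists_config : ∃ C : Finset (EuclideanSpace ℝ (Fin 4)), C.card = 10 ∧ (∀ x ∈ C, ‖x‖ = 1) ∧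
    (∀ x ∈ C, ∀ y ∈ C, x ≠ y → inner ℝ x y ≤ 1 / 6) ∧
    ∀ a : ℝ → ℝ, ∑ x ∈ C, ∑ y ∈ C.erase x, a (inner ℝ x y) =
      (10 : ℝ) * (3 * a (-2 / 3) + 6 * a (1 / 6)) := by
  obtain ⟨C, hc, hn, hi, he⟩ := exists_section Int.cast_injective hq shape_vecs keys_table hist_vecs
    nodup_vecs normals normals_ok orth_ok (n := 4) (by decide)
  refine ⟨C, by rw [hc, length_vecs], hn, fun x hx y hy hxy => ?_, fun a => ?_⟩
  · obtain ⟨p, hp, hpe⟩ := hi x hx y hy hxy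
    rw [hpe]
    simp only [table, List.mem_cons, List.not_mem_nil, or_false] at hp
    rcases hp with rfl | rfl <;> norm_num
  · rw [he a, length_vecs]
    simp only [table, List.map_cons, List.map_nil, List.sum_cons, List.sum_nil, Nat.cast_ofNat]
    norm_num

/-- **`A(4, arccos 1/6) ≥ 10`**, attained side: `10` unit vectors of `ℝ⁴` with pairwise inner products `≤ 1/6`
(the Petersen code / rectified simplex). [cite: ConwaySloane1999, Ch. 9 Table 9.2] -/
theorem exists_code_10 : ∃ C : Finset (EuclideanSpace ℝ (Fin 4)),
    C.card = 10 ∧ (∀ x ∈ C, ‖x‖ = 1) ∧ (∀ x ∈ C, ∀ y ∈ C, x ≠ y → inner ℝ x y ≤ 1 / 6) := by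
  obtain ⟨C, hc, hn, hi, _⟩ := exists_config
  exact ⟨C, hc, hn, hi⟩

/-- **`A(4, arccos s) ≥ 10` for every `s ≥ 1/6`** (in particular at `s = 1/5`, the B2c grid angle). -/
theorem exists_code_10_of_le {s : ℝ} (hs : (1 / 6 : ℝ) ≤ s) : ∃ C : Finset (EuclideanSpace ℝ (Fin 4)),
    C.card = 10 ∧ (∀ x ∈ C, ‖x‖ = 1) ∧ (∀ x ∈ C, ∀ y ∈ C, x ≠ y → inner ℝ x y ≤ s) := by
  obtain ⟨C, hc, hn, hi⟩ := exists_code_10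
  exact ⟨C, hc, hn, fun x hx y hy hxy => (hi x hx y hy hxy).trans hs⟩

/-- **`10 ≤ A(4, arccos 1/5) ≤ 11` in the kernel** (attained: the Petersen code, pairwise `≤ 1/6 ≤ 1/5`; upper:
the cell's kernel-checked Delsarte certificate `SphericalCodes.code_dim4_fifth_le_11`; the cell's exact
Bachoc–Vallentin three-point certificate gives `≤ 10`, i.e. `A(4, arccos 1/5) = 10`, but is not kernel-checked).
[cite: ConwaySloane1999, Ch. 9 Table 9.2] -/
theorem code_dim4_fifth_bracket :
    (∃ C : Finset (EuclideanSpace ℝ (Fin 4)), C.card = 10 ∧ (∀ x ∈ C, ‖x‖ = 1) ∧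
      (∀ x ∈ C, ∀ y ∈ C, x ≠ y → inner ℝ x y ≤ 1 / 5)) ∧
    ∀ C : Finset (EuclideanSpace ℝ (Fin 4)), (∀ x ∈ C, ‖x‖ = 1) →
      (∀ x ∈ C, ∀ y ∈ C, x ≠ y → inner ℝ x y ≤ 1 / 5) → C.card ≤ 11 :=
  ⟨exists_code_10_of_le (by norm_num), SphericalCodes.code_dim4_fifth_le_11⟩

end Summit.Ventures.PackingBounds.Config.PetersenCode
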